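/-
Copyright (c) 2026 the pub-hodgecm-mathlib formalisation cell (harness21).  Prover seat hodgecm-mathlib-LH7-p08 (g3) (Track A hand on the K2 L1 strike line),
hLiu418 = `stmt-HodgeConjecture-24832`; FACE-D₀ residue-side hole `hfac_of_residue`, K2E3-p23 (g9) census (V2) b0a853f114a703e2 organ (O3); LEAD F0P6-plan (g16)
BATCH #294 (4); FACE-D₀ desk K2Liu-p02 (g10); 2026-09-05.
-/
import Summits.HodgeConjecture.HodgeConjecture.Theorems.K2LiuThetaSideRankOneIndexGlobalGramHerm   -- ★ B3-3 (+ Herm ED. 2): `dictNeg_injective`, `dictNeg_mem_skewMatrices`, `eq_mul_conj_mul_self_of_eq_smul_vecMulVec`; ★ `K2LiuHermitianSkewDictionary`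
import Summits.HodgeConjecture.HodgeConjecture.Theorems.K2LiuRankOneOrbitUniformity               -- ★ U2c: `locF` currency (`locF_eq_of_eq_mul_conjLocal`), ★ Lit `Liu2021.Def411WeilCarriers.locF`
import Summits.HodgeConjecture.HodgeConjecture.Theorems.K2LiuIncoherentRankOneBadPlaceDichotomy     -- ★ the square-class bridge `δ² = θ·r²`: `hilbertSymbol_imagUnitSq_eq_cmQuadraticGenerator`
import Summits.HodgeConjecture.HodgeConjecture.Theorems.K2LiuIncoherentRankOneIndexValueOfRecord    -- ★ `hilbertSymbol_mul_norm_adicCompletion` (norms do not move `(·, θ)_v`), `complexConj_mul_self_mem`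
import Literature.NumberTheory.QuadraticForms.HilbertSymbolBilinear                                -- ★ `hilbertSymbol_adicCompletion_mul_left` (local bimultiplicativity)
import HarnessLib

/-!
# Crux `HLiu418`, FACE-D₀ residue side, organ (O3): THE RANK-ONE INDEX CLASS DICTIONARY — the conjugate dictionary `dict′ β = (−δ)·T_L⁻¹·β^{ρ⁻¹}`
# (rank, vanishing), the Gram value of `dict′(b · c(u) ⊗ u)` («`≡ b ·` unit of record mod norms»), and «Hilbert symbol `−1` ⇔ different line classes `locF`»

Cell `hodgecm-mathlib`, crux item hLiu418 = `stmt-HodgeConjecture-24832`; squad K2, strike line L1, LEAD F0P6-plan (g16) (BATCH #294 (4)); FACE-D₀ desk K2Liu-p02 (g10);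
second reader K2E3-p23 (g9) (census (V2) `K2/K2E3-p23/g9/CENSUS-BATCH290-hfac_of_residue.K2E3-p23-g9.md` §2 (O3)); consumers: (O2) `K2LiuCoherentRankOneDeadAtPlace`
(turns block D's dead-place symbol condition into `locF`) and (O1) `K2LiuResidueCoefficientsCoherentReading` (rank∕determinant transport only).  Pure algebra; THEOREMS ONLY
(no `def`, no instance, no notation, no named-fact hypothesis, no `sorry`); lane `--supports stmt-HodgeConjecture-24832 --as helper` (count-neutral).

THE OBJECTS.  `T_L = gramR ⊗ L` (★), `δ = imagUnit L` (★), `θ = cmQuadraticGenerator L` (★; `L = L⁺(√θ)`, `δ² = θ·r²` ★), `c` = complex conjugation.  The CONJUGATE DICTIONARY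
of M-160i (rows keyed on `−β`) sends a hermitian `β ∈ M₂(L)` to the `T_L`-skew Fourier index `dict′ β := (−δ) • (T_L⁻¹ · reindex ρ.symm ρ.symm β)` (★ B3-3 `dictNeg_injective`,
★ Herm `dictNeg_mem_skewMatrices`; the `+δ` dictionary with its API is ★ `K2LiuHermitianSkewDictionary`).  A rank-one hermitian `β` is a line Gram `b • c(u) ⊗ u`
(★ U2c `exists_eq_smul_vecMulVec_conj_of_det_eq_zero`); its LINE CLASS at a finite place `v` of `L⁺` is ★ `locF L⁺ (imagUnitSq L) b v ∈ L⁺_v^× ∕ Nm(L_v^×)` [Liu2021, Def. 4.11–4.12].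
Block D's dead-place test (★ `hdead_blockD_of_record`, abstract `val`) reads, at the coherent datum `S₁ = ∅`, `(val X, θ)_v = −1`; the value of record is a GRAM VALUE of
the index (★ (V-b) `K2LiuRankOneIndexValueTwoGram.exists_gram_presentation`: `α • (T_L·X) = (val₂ X·α²·T_bb) • c(u′) ⊗ u′`, `u′_k = 1`; `val° = val₂·N(t)` ★).

CONTENTS.
* §1 `dict′` transport: `smul_mul_dictNeg` (`α • (T_L · dict′ β) = (−αδ) • β^{ρ⁻¹}`), `det_dictNeg_ne_zero_iff` ∕ `det_dictNeg_eq_zero_iff` (RANK through `dict′`),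
  `dictNeg_eq_zero_iff`, `dictNeg_ne_zero_and_det_eq_zero_iff` (rank ONE ⇔ rank one) — the ★ `+δ` API at `δ := −δ`.
* §2 THE GRAM VALUE OF `dict′(b • c(u) ⊗ u)`: `reindex_smul_vecMulVec`, and **`gramValue_dictNeg_smul_vecMulVec`** — whenever `α • (T_L · dict′(b • c(u)⊗u)) = W • c(u′) ⊗ u′`
  with `u′_k = 1` (the shape ★ `exists_gram_presentation` delivers, `W = val₂ X·α²·T_bb`), then **`W = −(α·δ)·b·(c(u(ρ k))·u(ρ k))`**: the index value of `dict′(b•c(u)⊗u)` is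
  `b` times the constant `−αδ∕(α² T_bb) ∈ L⁺` («unit of record») times a NORM (★ B3-3 `eq_mul_conj_mul_self_of_eq_smul_vecMulVec`).
* §3 «SYMBOL `−1` ⇔ DIFFERENT LINE CLASSES»: **`hilbertSymbol_div_eq_neg_one_iff_locF_ne`** — `(ι_v(b·a⁻¹), θ)_v = −1 ↔ locF b v ≠ locF a v` (★ Lit
  `hilbertSymbol_eq_neg_one_iff_not_mem_quadraticNormSubgroup`, ★ bridge `(·, δ²)_v = (·, θ)_v`, ★ `locF_apply`), and `locF_eq_iff_hilbertSymbol_eq_one`.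
* §4 THE TWO READINGS of block D's dead-place test `(val X, θ)_v = −1` at `X = dict′(b•c(u)⊗u)` (desk K2Liu-p02 WORD #18: both typed; (O2) instantiates):
  `hilbertSymbol_eq_of_mul_norm_eq` (norm-related values have the same symbol, ★ `hilbertSymbol_mul_norm_adicCompletion`); RELATIVE, constant-free, against the
  line's own index `X₀ = dict′(a′•c(e₀)⊗e₀)`: **`hilbertSymbol_valueRatio_eq_neg_one_iff_locF_ne`** — from the two §2 identities `w·C = K·b·N(t)`, `w₀·C = K·a′·N(t₀)`,
  `(ι_v(w·w₀⁻¹), θ)_v = −1 ↔ locF b v ≠ locF a′ v`; ABSOLUTE, split at the line: **`hilbertSymbol_unit_mul_eq_neg_one_iff_locF_ne`** — for a unit of record `κ` with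
  `(ι_v(κ·a′), θ)_v = +1` (the line's own index is live), `(ι_v(κ·b), θ)_v = −1 ↔ locF b v ≠ locF a′ v` (★ local bimultiplicativity).
References: [Shimura1997, §18.1 (18.4), §18.4], [KudlaRallis1994, §3], [Scharlau1985HermitianForms, Ch. 10 §1], [Omeara1963, §63B], [Liu2021, Def. 4.11–4.12].

HONEST LABEL.  Count-neutral helper: `HC_CM` is proved only modulo the 7 printed citations (2 remaining named inputs: hLiu418 = `stmt-HodgeConjecture-24832`,
h413 = `stmt-HodgeConjecture-24833`) until rung 0 closes; (O1)/(O2) and the hole `hfac_of_residue` stay OPEN.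
-/

set_option autoImplicit false
set_option linter.dupNamespace false -- the mandated namespace repeats `HodgeConjecture.HodgeConjecture`

noncomputable section

open scoped Matrix
open NumberField IsDedekindDomain
open Literature.NumberTheory.QuadraticForms
open Literature.NumberTheory.Automorphic Literature.NumberTheory.Automorphic.UnitaryGroup Literature.NumberTheory.GaloisRepresentations
open Literature.NumberTheory.Automorphic.Liu2021.Def411WeilCarriers
open Literature.NumberTheory.GelbartRogawski1991 Literature.NumberTheory.GelbartRogawski1991.GRConstruction
open Literature.NumberTheory.GelbartRogawski1991.UnitaryDualPair
open Summit.HodgeConjecture.HodgeConjecture.Cruxes.HLiu418.K2LiuSiegelUnipotentFourierDefs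
open Summit.HodgeConjecture.HodgeConjecture.Cruxes.HLiu418.K2LiuHermitianSkewDictionary
open Summit.HodgeConjecture.HodgeConjecture.Cruxes.HLiu418.K2LiuThetaSideRankOneIndexGlobalGram (dictNeg_injective eq_mul_conj_mul_self_of_eq_smul_vecMulVec)
open Summit.HodgeConjecture.HodgeConjecture.Cruxes.HLiu418.K2LiuIncoherentRankOneBadPlaceDichotomy (hilbertSymbol_imagUnitSq_eq_cmQuadraticGenerator)
open Summit.HodgeConjecture.HodgeConjecture.Cruxes.HLiu418.K2LiuIncoherentRankOneIndexValueOfRecord (hilbertSymbol_mul_norm_adicCompletion complexConj_mul_self_mem)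

namespace Summit.HodgeConjecture.HodgeConjecture.Cruxes.HLiu418.K2LiuRankOneIndexClassDictionary

variable (L : Type) [Field L] [NumberField L] [IsCMField L]
variable {N M n : ℕ} (e : Fin N × Fin M ≃ Fin n)
  (dV : Fin N → L) (hdV : ∀ i, IsCMField.complexConj L (dV i) = dV i) (hdV0 : ∀ i, dV i ≠ 0)
  (dW : Fin M → L) (hdW : ∀ i, IsCMField.complexConj L (dW i) = dW i) (hdW0 : ∀ i, dW i ≠ 0)

/-! ## §1 `dict′` transport: Gram matrix, rank, vanishing -/

include hdV0 hdW0 in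
/-- **`α • (T_L · dict′ β) = (−α·δ) • β^{ρ⁻¹}`** — the hermitian matrix of the conjugate index (`T_L · T_L⁻¹ = 1`, ★ `isUnit_det_gramRL`). [cite: Shimura1997, §18.1 (18.4)] -/
theorem smul_mul_dictNeg (ρ : Fin n ≃ Fin 2) (α : L) (β : Matrix (Fin 2) (Fin 2) L) :
    α • ((gramR L e dV hdV dW hdW).map (algebraMap (Fp L) L) *
        ((-imagUnit L) • (((gramR L e dV hdV dW hdW).map (algebraMap (Fp L) L))⁻¹ * Matrix.reindex ρ.symm ρ.symm β))) =
      (-(α * imagUnit L)) • Matrix.reindex ρ.symm ρ.symm β := by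
  rw [Matrix.mul_smul, ← Matrix.mul_assoc, Matrix.mul_nonsing_inv _ (isUnit_det_gramRL L e dV hdV dW hdW hdV0 hdW0), Matrix.one_mul, smul_smul,
    mul_neg]

include hdV0 hdW0 in
/-- **RANK TWO through `dict′`**: `det (dict′ β) ≠ 0 ↔ det β ≠ 0` (★ `det_smul_inv_mul_ne_zero` at `δ := −δ`; conversely `det (dict′ β) = (−δ)ⁿ det(T_L)⁻¹ det β`).
[cite: Shimura1997, §18.1 (18.4)] -/
theorem det_dictNeg_ne_zero_iff (ρ : Fin n ≃ Fin 2) (β : Matrix (Fin 2) (Fin 2) L) :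
    ((-imagUnit L) • (((gramR L e dV hdV dW hdW).map (algebraMap (Fp L) L))⁻¹ * Matrix.reindex ρ.symm ρ.symm β)).det ≠ 0 ↔ β.det ≠ 0 := by
  refine ⟨fun h hβ => h ?_, fun hβ => det_smul_inv_mul_ne_zero (isUnit_det_gramRL L e dV hdV dW hdW hdV0 hdW0) (neg_ne_zero.2 (imagUnit_ne_zero L)) _
    (by rwa [Matrix.det_reindex_self])⟩
  rw [Matrix.det_smul, Matrix.det_mul, Matrix.det_reindex_self, hβ, mul_zero, mul_zero]

include hdV0 hdW0 in
/-- **RANK AT MOST ONE through `dict′`**: `det (dict′ β) = 0 ↔ det β = 0`. [cite: Shimura1997, §18.1 (18.4)] -/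
theorem det_dictNeg_eq_zero_iff (ρ : Fin n ≃ Fin 2) (β : Matrix (Fin 2) (Fin 2) L) :
    ((-imagUnit L) • (((gramR L e dV hdV dW hdW).map (algebraMap (Fp L) L))⁻¹ * Matrix.reindex ρ.symm ρ.symm β)).det = 0 ↔ β.det = 0 := by
  have h := det_dictNeg_ne_zero_iff L e dV hdV hdV0 dW hdW hdW0 ρ β
  tauto

include hdV0 hdW0 in
/-- **`dict′ β = 0 ↔ β = 0`** (★ `eq_zero_of_smul_inv_mul_eq_zero` at `δ := −δ`). [folklore] -/
theorem dictNeg_eq_zero_iff (ρ : Fin n ≃ Fin 2) (β : Matrix (Fin 2) (Fin 2) L) :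
    (-imagUnit L) • (((gramR L e dV hdV dW hdW).map (algebraMap (Fp L) L))⁻¹ * Matrix.reindex ρ.symm ρ.symm β) = 0 ↔ β = 0 := by
  constructor
  · intro h
    have h' := eq_zero_of_smul_inv_mul_eq_zero (isUnit_det_gramRL L e dV hdV dW hdW hdV0 hdW0) (neg_ne_zero.2 (imagUnit_ne_zero L)) _ h
    rw [← (Matrix.reindex ρ.symm ρ.symm).symm_apply_apply β, h', Matrix.reindex_symm, reindex_zero_sq]
  · rintro rfl
    rw [reindex_zero_sq, Matrix.mul_zero, smul_zero]

include hdV0 hdW0 in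
/-- **RANK ONE through `dict′`**: `dict′ β ≠ 0 ∧ det (dict′ β) = 0 ↔ β ≠ 0 ∧ det β = 0` — the hypothesis pair of block D's rows and of ★ `exists_gram_presentation`.
[cite: Shimura1997, §18.1 (18.4)] [cite: KudlaRallis1994, §3] -/
theorem dictNeg_ne_zero_and_det_eq_zero_iff (ρ : Fin n ≃ Fin 2) (β : Matrix (Fin 2) (Fin 2) L) :
    ((-imagUnit L) • (((gramR L e dV hdV dW hdW).map (algebraMap (Fp L) L))⁻¹ * Matrix.reindex ρ.symm ρ.symm β) ≠ 0 ∧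
        ((-imagUnit L) • (((gramR L e dV hdV dW hdW).map (algebraMap (Fp L) L))⁻¹ * Matrix.reindex ρ.symm ρ.symm β)).det = 0) ↔
      (β ≠ 0 ∧ β.det = 0) := by
  rw [ne_eq, dictNeg_eq_zero_iff L e dV hdV hdV0 dW hdW hdW0, det_dictNeg_eq_zero_iff L e dV hdV hdV0 dW hdW hdW0]

/-! ## §2 The Gram value of `dict′(b • c(u) ⊗ u)` -/

/-- re-enumerating a line Gram: `(b • c(u) ⊗ u)^{ρ⁻¹} = b • c(u ∘ ρ) ⊗ (u ∘ ρ)`. [folklore] -/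
theorem reindex_smul_vecMulVec {R : Type*} [CommRing R] (σ : R →+* R) (ρ : Fin n ≃ Fin 2) (b : R) (u : Fin 2 → R) :
    Matrix.reindex ρ.symm ρ.symm (b • Matrix.vecMulVec (σ ∘ u) u) = b • Matrix.vecMulVec (σ ∘ (u ∘ ρ)) (u ∘ ρ) := by
  ext i j
  simp [Matrix.vecMulVec_apply, Matrix.submatrix_apply]

include hdV0 hdW0 in
/-- **THE GRAM VALUE OF `dict′(b • c(u) ⊗ u)`.**  If `α • (T_L · dict′(b • c(u) ⊗ u)) = W • c(u′) ⊗ u′` with `u′_k = 1` — the presentation ★ `exists_gram_presentation` delivers for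
the rank-one index `X = dict′(b • c(u) ⊗ u)` with `W = val₂ X · α² · T_bb` — then `W = −(α·δ) · b · (c(u(ρ k)) · u(ρ k))`: the index value is `b` times the constant `−δ∕(α·T_bb)`
times a NORM.  (§1 `smul_mul_dictNeg` + ★ B3-3 `eq_mul_conj_mul_self_of_eq_smul_vecMulVec`.) [cite: KudlaRallis1994, §3] [cite: Scharlau1985HermitianForms, Ch. 10 §1]
[cite: Shimura1997, §18.4] -/
theorem gramValue_dictNeg_smul_vecMulVec (ρ : Fin n ≃ Fin 2) (α b : L) (u : Fin 2 → L) {W : L} {u' : Fin n → L} {k : Fin n} (hk : u' k = 1)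
    (hpres : α • ((gramR L e dV hdV dW hdW).map (algebraMap (Fp L) L) *
        ((-imagUnit L) • (((gramR L e dV hdV dW hdW).map (algebraMap (Fp L) L))⁻¹ *
          Matrix.reindex ρ.symm ρ.symm (b • Matrix.vecMulVec (((IsCMField.complexConj L : L ≃ₐ[Fp L] L) : L →+* L) ∘ u) u)))) =
      W • Matrix.vecMulVec (((IsCMField.complexConj L : L ≃ₐ[Fp L] L) : L →+* L) ∘ u') u') :
    W = -(α * imagUnit L) * b * (IsCMField.complexConj L (u (ρ k)) * u (ρ k)) := by
  rw [smul_mul_dictNeg L e dV hdV hdV0 dW hdW hdW0, reindex_smul_vecMulVec, smul_smul] at hpres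
  have h := eq_mul_conj_mul_self_of_eq_smul_vecMulVec (((IsCMField.complexConj L : L ≃ₐ[Fp L] L) : L →+* L)) hk hpres.symm
  rw [h]
  rfl

/-! ## §3 «Hilbert symbol `−1` ⇔ different line classes» -/

/-- **SYMBOL `−1` ⇔ DIFFERENT LINE CLASSES**: for `a, b ∈ L⁺ˣ` and a finite place `v` of `L⁺`, `(ι_v(b·a⁻¹), θ)_v = −1 ↔ locF b v ≠ locF a v` — the Hilbert symbol with
`θ` detects the norm residue class (★ Lit `hilbertSymbol_eq_neg_one_iff_not_mem_quadraticNormSubgroup`), `(·, δ²)_v = (·, θ)_v` (★ square-class bridge), and `locF` is the class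
mod `Nm = quadraticNormSubgroup (ι_v δ²)` (★ `locF_apply`). [cite: Liu2021, Def. 4.11–4.12] [cite: Omeara1963, §63B] -/
theorem hilbertSymbol_div_eq_neg_one_iff_locF_ne (a b : (↥(maximalRealSubfield L))ˣ) (v : HeightOneSpectrum (𝓞 ↥(maximalRealSubfield L))) :
    hilbertSymbol (v.adicCompletion ↥(maximalRealSubfield L))
        (algebraMap ↥(maximalRealSubfield L) (v.adicCompletion ↥(maximalRealSubfield L)) ((b * a⁻¹ : (↥(maximalRealSubfield L))ˣ) : ↥(maximalRealSubfield L)))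
        (algebraMap ↥(maximalRealSubfield L) (v.adicCompletion ↥(maximalRealSubfield L)) (cmQuadraticGenerator L : ↥(maximalRealSubfield L))) = -1 ↔
      locF ↥(maximalRealSubfield L) (imagUnitSq L) b v ≠ locF ↥(maximalRealSubfield L) (imagUnitSq L) a v := by
  haveI : CharZero (v.adicCompletion ↥(maximalRealSubfield L)) :=
    charZero_of_injective_algebraMap (algebraMap ↥(maximalRealSubfield L) (v.adicCompletion ↥(maximalRealSubfield L))).injective
  haveI : NeZero (2 : v.adicCompletion ↥(maximalRealSubfield L)) := ⟨two_ne_zero⟩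
  have hd0 : (imagUnitSq L : ↥(maximalRealSubfield L)) ≠ 0 := fun h0 => by
    have h := imagUnit_mul_self L
    rw [h0, map_zero, mul_self_eq_zero] at h
    exact imagUnit_ne_zero L h
  have hδ0 : algebraMap ↥(maximalRealSubfield L) (v.adicCompletion ↥(maximalRealSubfield L)) (imagUnitSq L) ≠ 0 := (map_ne_zero _).2 hd0
  set φ : ↥(maximalRealSubfield L) →* v.adicCompletion ↥(maximalRealSubfield L) :=
    (algebraMap ↥(maximalRealSubfield L) (v.adicCompletion ↥(maximalRealSubfield L))).toMonoidHom with hφ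
  -- the unit `(ι a)⁻¹ · ι b` represents `ι(b · a⁻¹)`
  have hval : (((Units.map φ a)⁻¹ * Units.map φ b : (v.adicCompletion ↥(maximalRealSubfield L))ˣ) : v.adicCompletion ↥(maximalRealSubfield L)) =
      algebraMap ↥(maximalRealSubfield L) (v.adicCompletion ↥(maximalRealSubfield L)) ((b * a⁻¹ : (↥(maximalRealSubfield L))ˣ) : ↥(maximalRealSubfield L)) := by
    rw [Units.val_mul, Units.val_inv_eq_inv_val, Units.val_mul, Units.val_inv_eq_inv_val, map_mul, map_inv₀, mul_comm]
    rfl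
  rw [ne_comm, ne_eq, locF_apply, locF_apply, QuotientGroup.eq, ← hilbertSymbol_eq_neg_one_iff_not_mem_quadraticNormSubgroup hδ0, hval,
    ← hilbertSymbol_imagUnitSq_eq_cmQuadraticGenerator L v]
  rfl

/-- **… equivalently `locF b v = locF a v ↔ (ι_v(b·a⁻¹), θ)_v = 1`** (the symbol takes only the values `±1` on units, ★ `hilbertSymbol_eq_one_iff_mem_quadraticNormSubgroup`).
[cite: Liu2021, Def. 4.11–4.12] [cite: Omeara1963, §63B] -/
theorem locF_eq_iff_hilbertSymbol_eq_one (a b : (↥(maximalRealSubfield L))ˣ) (v : HeightOneSpectrum (𝓞 ↥(maximalRealSubfield L))) :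
    locF ↥(maximalRealSubfield L) (imagUnitSq L) b v = locF ↥(maximalRealSubfield L) (imagUnitSq L) a v ↔
      hilbertSymbol (v.adicCompletion ↥(maximalRealSubfield L))
        (algebraMap ↥(maximalRealSubfield L) (v.adicCompletion ↥(maximalRealSubfield L)) ((b * a⁻¹ : (↥(maximalRealSubfield L))ˣ) : ↥(maximalRealSubfield L)))
        (algebraMap ↥(maximalRealSubfield L) (v.adicCompletion ↥(maximalRealSubfield L)) (cmQuadraticGenerator L : ↥(maximalRealSubfield L))) = 1 := by
  haveI : CharZero (v.adicCompletion ↥(maximalRealSubfield L)) :=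
    charZero_of_injective_algebraMap (algebraMap ↥(maximalRealSubfield L) (v.adicCompletion ↥(maximalRealSubfield L))).injective
  haveI : NeZero (2 : v.adicCompletion ↥(maximalRealSubfield L)) := ⟨two_ne_zero⟩
  have hd0 : (imagUnitSq L : ↥(maximalRealSubfield L)) ≠ 0 := fun h0 => by
    have h := imagUnit_mul_self L
    rw [h0, map_zero, mul_self_eq_zero] at h
    exact imagUnit_ne_zero L h
  have hδ0 : algebraMap ↥(maximalRealSubfield L) (v.adicCompletion ↥(maximalRealSubfield L)) (imagUnitSq L) ≠ 0 := (map_ne_zero _).2 hd0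
  set φ : ↥(maximalRealSubfield L) →* v.adicCompletion ↥(maximalRealSubfield L) :=
    (algebraMap ↥(maximalRealSubfield L) (v.adicCompletion ↥(maximalRealSubfield L))).toMonoidHom with hφ
  have hval : (((Units.map φ a)⁻¹ * Units.map φ b : (v.adicCompletion ↥(maximalRealSubfield L))ˣ) : v.adicCompletion ↥(maximalRealSubfield L)) =
      algebraMap ↥(maximalRealSubfield L) (v.adicCompletion ↥(maximalRealSubfield L)) ((b * a⁻¹ : (↥(maximalRealSubfield L))ˣ) : ↥(maximalRealSubfield L)) := by
    rw [Units.val_mul, Units.val_inv_eq_inv_val, Units.val_mul, Units.val_inv_eq_inv_val, map_mul, map_inv₀, mul_comm]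
    rfl
  rw [locF_apply, locF_apply, eq_comm, QuotientGroup.eq, ← hilbertSymbol_eq_one_iff_mem_quadraticNormSubgroup hδ0, hval,
    ← hilbertSymbol_imagUnitSq_eq_cmQuadraticGenerator L v]
  rfl


/-! ## §4 The relative class reading of an index value against the line's own index -/

/-- **NORM-RELATED VALUES HAVE THE SAME SYMBOL**: if `x · N(t₀) = y · N(t)` in `L` (`x, y ∈ L⁺`, `t, t₀ ∈ L^×`, `N(s) = c s · s`) then `(ι_v x, θ)_v = (ι_v y, θ)_v`
(`x = y · N(t · t₀⁻¹)`, ★ `hilbertSymbol_mul_norm_adicCompletion`). [cite: Omeara1963, §63B] -/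
theorem hilbertSymbol_eq_of_mul_norm_eq (v : HeightOneSpectrum (𝓞 ↥(maximalRealSubfield L))) {x y : ↥(maximalRealSubfield L)} {t t₀ : L}
    (ht : t ≠ 0) (ht₀ : t₀ ≠ 0) (h : (x : L) * (IsCMField.complexConj L t₀ * t₀) = (y : L) * (IsCMField.complexConj L t * t)) :
    hilbertSymbol (v.adicCompletion ↥(maximalRealSubfield L)) (algebraMap ↥(maximalRealSubfield L) (v.adicCompletion ↥(maximalRealSubfield L)) x)
        (algebraMap ↥(maximalRealSubfield L) (v.adicCompletion ↥(maximalRealSubfield L)) (cmQuadraticGenerator L : ↥(maximalRealSubfield L))) =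
      hilbertSymbol (v.adicCompletion ↥(maximalRealSubfield L)) (algebraMap ↥(maximalRealSubfield L) (v.adicCompletion ↥(maximalRealSubfield L)) y)
        (algebraMap ↥(maximalRealSubfield L) (v.adicCompletion ↥(maximalRealSubfield L)) (cmQuadraticGenerator L : ↥(maximalRealSubfield L))) := by
  have hc₀ : IsCMField.complexConj L t₀ ≠ 0 := (map_ne_zero _).2 ht₀
  -- `x = y · N(t t₀⁻¹)` in `L⁺`
  have hxy : x = y * ⟨IsCMField.complexConj L (t * t₀⁻¹) * (t * t₀⁻¹), complexConj_mul_self_mem L _⟩ := by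
    apply Subtype.ext
    change (x : L) = (y : L) * (IsCMField.complexConj L (t * t₀⁻¹) * (t * t₀⁻¹))
    rw [map_mul, map_inv₀]
    field_simp
    linear_combination h
  rw [hxy, map_mul, hilbertSymbol_mul_norm_adicCompletion L v _ (mul_ne_zero ht (inv_ne_zero ht₀))]

/-- **THE RELATIVE CLASS READING**: let `w, w₀ ∈ L⁺` be Gram values of the indices `dict′(b • c(u) ⊗ u)` and `dict′(a′ • c(e₀) ⊗ e₀)` in the sense of §2 — `w · C = K · b · N(t)`,
`w₀ · C = K · a′ · N(t₀)` with the same constants `C ≠ 0` (`= α²·T_bb`), `K` (`= −α·δ`) and norms `N(t), N(t₀)`, `t, t₀ ≠ 0` (§2 gives `t = u(ρ k)`, `t₀ = e₀(ρ k₀)`) — then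
**`(ι_v(w · w₀⁻¹), θ)_v = −1 ↔ locF b v ≠ locF a′ v`**: block D's dead-place test on the RATIO of index values reads the line class of `b` against `a′`, constant-free.
[cite: Liu2021, Def. 4.11–4.12] [cite: Omeara1963, §63B] [cite: KudlaRallis1994, §3] -/
theorem hilbertSymbol_valueRatio_eq_neg_one_iff_locF_ne (v : HeightOneSpectrum (𝓞 ↥(maximalRealSubfield L))) (a' b : (↥(maximalRealSubfield L))ˣ)
    {w w₀ : ↥(maximalRealSubfield L)} (hw₀0 : w₀ ≠ 0) {K C : L} (hC : C ≠ 0) {t t₀ : L} (ht : t ≠ 0) (ht₀ : t₀ ≠ 0)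
    (hw : (w : L) * C = K * ((b : ↥(maximalRealSubfield L)) : L) * (IsCMField.complexConj L t * t))
    (hw₀ : (w₀ : L) * C = K * ((a' : ↥(maximalRealSubfield L)) : L) * (IsCMField.complexConj L t₀ * t₀)) :
    hilbertSymbol (v.adicCompletion ↥(maximalRealSubfield L))
        (algebraMap ↥(maximalRealSubfield L) (v.adicCompletion ↥(maximalRealSubfield L)) (w * w₀⁻¹))
        (algebraMap ↥(maximalRealSubfield L) (v.adicCompletion ↥(maximalRealSubfield L)) (cmQuadraticGenerator L : ↥(maximalRealSubfield L))) = -1 ↔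
      locF ↥(maximalRealSubfield L) (imagUnitSq L) b v ≠ locF ↥(maximalRealSubfield L) (imagUnitSq L) a' v := by
  rw [← hilbertSymbol_div_eq_neg_one_iff_locF_ne L a' b v]
  -- `(w/w₀) · N(t₀) = (b/a′) · N(t)` in `L`
  have ha0 : ((a' : ↥(maximalRealSubfield L)) : L) ≠ 0 := by
    rw [ne_eq, ZeroMemClass.coe_eq_zero]
    exact a'.ne_zero
  have hw0L : ((w₀ : ↥(maximalRealSubfield L)) : L) ≠ 0 := by
    rw [ne_eq, ZeroMemClass.coe_eq_zero]
    exact hw₀0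
  have hrel : ((w * w₀⁻¹ : ↥(maximalRealSubfield L)) : L) * (IsCMField.complexConj L t₀ * t₀) =
      (((b * a'⁻¹ : (↥(maximalRealSubfield L))ˣ) : ↥(maximalRealSubfield L)) : L) * (IsCMField.complexConj L t * t) := by
    have h1 : ((w * w₀⁻¹ : ↥(maximalRealSubfield L)) : L) = (w : L) * ((w₀ : L))⁻¹ := by push_cast; rfl
    have h2 : (((b * a'⁻¹ : (↥(maximalRealSubfield L))ˣ) : ↥(maximalRealSubfield L)) : L) =
        ((b : ↥(maximalRealSubfield L)) : L) * (((a' : ↥(maximalRealSubfield L)) : L))⁻¹ := by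
      rw [Units.val_mul, Units.val_inv_eq_inv_val]; push_cast; rfl
    rw [h1, h2]
    field_simp [ha0, hw0L]
    -- `w · a′ · N(t₀) · … = b · w₀ · N(t) · …`: both sides times `C · K` agree by `hw`, `hw₀`
    have key : (w : L) * ((a' : ↥(maximalRealSubfield L)) : L) * (IsCMField.complexConj L t₀ * t₀) * C =
        ((b : ↥(maximalRealSubfield L)) : L) * (w₀ : L) * (IsCMField.complexConj L t * t) * C := by
      linear_combination (((a' : ↥(maximalRealSubfield L)) : L) * (IsCMField.complexConj L t₀ * t₀)) * hw -
        (((b : ↥(maximalRealSubfield L)) : L) * (IsCMField.complexConj L t * t)) * hw₀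
    have key' := mul_right_cancel₀ hC key
    linear_combination key'
  rw [hilbertSymbol_eq_of_mul_norm_eq L v ht ht₀ hrel]

/-- **THE ABSOLUTE CLASS READING, SPLIT AT THE LINE**: for a unit of record `κ ∈ L⁺ˣ` with `(ι_v(κ·a′), θ)_v = +1` (the line's own index `dict′(a′•c(e₀)⊗e₀)` is LIVE at `v`),
`(ι_v(κ·b), θ)_v = −1 ↔ locF b v ≠ locF a′ v` (local bimultiplicativity ★ `hilbertSymbol_adicCompletion_mul_left` + §3). [cite: Omeara1963, §63B] [cite: Liu2021, Def. 4.11–4.12] -/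
theorem hilbertSymbol_unit_mul_eq_neg_one_iff_locF_ne (v : HeightOneSpectrum (𝓞 ↥(maximalRealSubfield L))) {κ : ↥(maximalRealSubfield L)} (hκ : κ ≠ 0)
    (a' b : (↥(maximalRealSubfield L))ˣ)
    (hline : hilbertSymbol (v.adicCompletion ↥(maximalRealSubfield L))
        (algebraMap ↥(maximalRealSubfield L) (v.adicCompletion ↥(maximalRealSubfield L)) (κ * (a' : ↥(maximalRealSubfield L))))
        (algebraMap ↥(maximalRealSubfield L) (v.adicCompletion ↥(maximalRealSubfield L)) (cmQuadraticGenerator L : ↥(maximalRealSubfield L))) = 1) :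
    hilbertSymbol (v.adicCompletion ↥(maximalRealSubfield L))
        (algebraMap ↥(maximalRealSubfield L) (v.adicCompletion ↥(maximalRealSubfield L)) (κ * (b : ↥(maximalRealSubfield L))))
        (algebraMap ↥(maximalRealSubfield L) (v.adicCompletion ↥(maximalRealSubfield L)) (cmQuadraticGenerator L : ↥(maximalRealSubfield L))) = -1 ↔
      locF ↥(maximalRealSubfield L) (imagUnitSq L) b v ≠ locF ↥(maximalRealSubfield L) (imagUnitSq L) a' v := by
  rw [← hilbertSymbol_div_eq_neg_one_iff_locF_ne L a' b v]
  have hθ0 : algebraMap ↥(maximalRealSubfield L) (v.adicCompletion ↥(maximalRealSubfield L)) (cmQuadraticGenerator L : ↥(maximalRealSubfield L)) ≠ 0 :=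
    (map_ne_zero _).2 fun h => not_isSquare_cmQuadraticGenerator L (h ▸ IsSquare.zero)
  have hx : algebraMap ↥(maximalRealSubfield L) (v.adicCompletion ↥(maximalRealSubfield L)) (κ * (a' : ↥(maximalRealSubfield L))) ≠ 0 :=
    (map_ne_zero _).2 (mul_ne_zero hκ a'.ne_zero)
  have hy : algebraMap ↥(maximalRealSubfield L) (v.adicCompletion ↥(maximalRealSubfield L)) ((b * a'⁻¹ : (↥(maximalRealSubfield L))ˣ) : ↥(maximalRealSubfield L)) ≠ 0 :=
    (map_ne_zero _).2 (b * a'⁻¹).ne_zero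
  have hsplit : κ * (b : ↥(maximalRealSubfield L)) = (κ * (a' : ↥(maximalRealSubfield L))) * ((b * a'⁻¹ : (↥(maximalRealSubfield L))ˣ) : ↥(maximalRealSubfield L)) := by
    rw [Units.val_mul, Units.val_inv_eq_inv_val, mul_comm (b : ↥(maximalRealSubfield L)) ((a' : ↥(maximalRealSubfield L))⁻¹), ← mul_assoc,
      mul_assoc κ, mul_inv_cancel₀ a'.ne_zero, mul_one]
  rw [hsplit, map_mul, hilbertSymbol_adicCompletion_mul_left (↥(maximalRealSubfield L)) v hx hy hθ0, hline, one_mul]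

end Summit.HodgeConjecture.HodgeConjecture.Cruxes.HLiu418.K2LiuRankOneIndexClassDictionary

end
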